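import Summits.KontsevichZagierPeriods.KontsevichZagierPeriods.Theorems.RootDecompQuadraticDescentGoldenPairP2

/-!
# DARK census pair #10 `[□²,1/(1−x+y+x²−y²)] ≡ 2·[□²,1/(1+y+2xy+y²)]` DECIDED in `KZ.relations` by rules 1+2 (route `RootDecompQuadraticDescent`, instance of crux stmt-KontsevichZagierPeriods-28994 `DescentTwoQ` / stmt-4280 `KZDimTwo`) · part 3/6

Cell `decomp-kz`, lens 6 (decomp-kz-lens-6 g8e): `pair10` — the golden-ratio dilogarithm pair of the weight-2 box census, decided with ℚ-data only (no power map, no Landen, no irrational cut); packaged `goldenPair_descentTwoQ_instance` (∀ R ⊇ relations) and `goldenPair_of_kzDimTwo` BY NAME over the born `KZDimTwo`; imports the LANDED `…DarkPairsEleven` reflection kit.  After this, the weight-2 box census has ONE open row (#18).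

Source: `HOME/decomp-kz-lens-6/g8/GoldenPair10.lean` sha256 3ad60a9384e30dab (1472 l; critic decomp-kz-crit-1 g2 CLEARED/kernel-confirmed 2026-08-30T10:32:33Z, std axioms), split into 6 modules by the landing seat decomp-kz-census-1 g7 (contexts re-opened per part; generic docstrings added where the source had none; the route file is imported only by the last part).  No `sorry`; standard axioms.  References: [cite: KontsevichZagier2001, §1.2].
-/

noncomputable section

open MeasureTheory Set MvPolynomial

namespace Summit.KontsevichZagierPeriods.RootDecompQuadraticDescent.GoldenPair

open Literature.NumberTheory.Transcendental
open Literature.NumberTheory.Transcendental.KZ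
open Literature.ModelTheory.ExponentialFields (IsSemialgebraic continuous_aeval_real)
open Summit.KontsevichZagierPeriods.RootDecompQuadraticDescent.DarkPairs (rel_reflect_rep rel_double
  update_one_apply_zero one_div_eq_mul_one_div)

-- PRIVATE copy (twin landed in SurdPairsP3; dedup.landed): rel_lin
/-- Linearity in the integrand (rule 1b). -/
private theorem rel_lin (T S U : RFun 2) (h : ∀ x ∈ cube 2, T.fn x = S.fn x + U.fn x) :
    KZ.of T.rep - KZ.of S.rep - KZ.of U.rep ∈ KZ.relations :=
  KZ.cubicalLinGens_subset_relations (KZ.mem_cubicalLinGens T.isTameCube_rep S.isTameCube_rep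
    U.isTameCube_rep fun x hx => by simpa using h x hx)

-- PRIVATE copy (landed twin elsewhere; dedup.landed): snoc2_zero, snoc2_one, init2_zero, injOn_image_of_deriv_pos, injOn_image_of_deriv_neg
/-- `snoc2_zero`: auxiliary theorem of the lens-6 g8e development GoldenPair10 (census pair #10; instances of 28994/4280) — see the module docstring; verbatim from the lens file. -/
@[simp] private theorem snoc2_zero (x : Fin 1 → ℝ) (t : ℝ) : (Fin.snoc x t : Fin 2 → ℝ) 0 = x 0 := rfl

/-- `snoc2_one`: auxiliary theorem of the lens-6 g8e development GoldenPair10 (census pair #10; instances of 28994/4280) — see the module docstring; verbatim from the lens file. -/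
@[simp] private theorem snoc2_one (x : Fin 1 → ℝ) (t : ℝ) : (Fin.snoc x t : Fin 2 → ℝ) 1 = t := rfl

/-- `init2_zero`: auxiliary theorem of the lens-6 g8e development GoldenPair10 (census pair #10; instances of 28994/4280) — see the module docstring; verbatim from the lens file. -/
@[simp] private theorem init2_zero (z : Fin 2 → ℝ) : Fin.init z 0 = z 0 := rfl

/-- Injectivity and image of an interval under a map with positive derivative in the interior. -/
private theorem injOn_image_of_deriv_pos' {κ κd : ℝ → ℝ} {a b : ℝ} (hab : a ≤ b)
    (hκd : ∀ t ∈ Icc a b, HasDerivAt κ (κd t) t) (hpos : ∀ t ∈ Ioo a b, 0 < κd t) :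
    InjOn κ (Icc a b) ∧ κ '' Icc a b = Icc (κ a) (κ b) := by
  have hc : ContinuousOn κ (Icc a b) := fun t ht => (hκd t ht).continuousAt.continuousWithinAt
  have hm : StrictMonoOn κ (Icc a b) := strictMonoOn_of_deriv_pos (convex_Icc a b) hc fun t ht => by
    rw [interior_Icc] at ht
    rw [(hκd t (Ioo_subset_Icc_self ht)).deriv]
    exact hpos t ht
  refine ⟨hm.injOn, Subset.antisymm ?_ (intermediate_value_Icc hab hc)⟩
  rintro _ ⟨t, ht, rfl⟩
  exact ⟨hm.monotoneOn (left_mem_Icc.2 hab) ht ht.1, hm.monotoneOn ht (right_mem_Icc.2 hab) ht.2⟩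

/-- … and with negative derivative in the interior (orientation reversed). -/
private theorem injOn_image_of_deriv_neg' {κ κd : ℝ → ℝ} {a b : ℝ} (hab : a ≤ b)
    (hκd : ∀ t ∈ Icc a b, HasDerivAt κ (κd t) t) (hneg : ∀ t ∈ Ioo a b, κd t < 0) :
    InjOn κ (Icc a b) ∧ κ '' Icc a b = Icc (κ b) (κ a) := by
  have hc : ContinuousOn κ (Icc a b) := fun t ht => (hκd t ht).continuousAt.continuousWithinAt
  have hm : StrictAntiOn κ (Icc a b) := strictAntiOn_of_deriv_neg (convex_Icc a b) hc fun t ht => by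
    rw [interior_Icc] at ht
    rw [(hκd t (Ioo_subset_Icc_self ht)).deriv]
    exact hneg t ht
  refine ⟨hm.injOn, Subset.antisymm ?_ (intermediate_value_Icc' hab hc)⟩
  rintro _ ⟨t, ht, rfl⟩
  exact ⟨hm.antitoneOn ht (right_mem_Icc.2 hab) ht.2, hm.antitoneOn (left_mem_Icc.2 hab) ht ht.1⟩

/-- `cmul_ge_neg`: auxiliary theorem of the lens-6 g8e development GoldenPair10 (census pair #10; instances of 28994/4280) — see the module docstring; verbatim from the lens file. -/
private theorem cmul_ge_neg {c : ℚ} (hc : -1 ≤ c ∧ c ≤ 1) {p : ℝ} (hp : 0 ≤ p) : -p ≤ (c : ℝ) * p := by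
  have h1 : (-1 : ℝ) ≤ c := by exact_mod_cast hc.1
  nlinarith

/-- The polynomial data. -/
def PΔ (c : ℚ) : MvPolynomial (Fin 2) ℚ := 1 + C c * X 0 * X 1
/-- `PΔs`: auxiliary def of the lens-6 g8e development GoldenPair10 (census pair #10; instances of 28994/4280) — see the module docstring; verbatim from the lens file. -/
def PΔs (c : ℚ) : MvPolynomial (Fin 2) ℚ := 1 + C c * X 0 * (X 1 - 1)
/-- `Q1`: auxiliary def of the lens-6 g8e development GoldenPair10 (census pair #10; instances of 28994/4280) — see the module docstring; verbatim from the lens file. -/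
def Q1 (c : ℚ) : MvPolynomial (Fin 2) ℚ := (1 + X 0) * (1 + X 0 + C c * (X 1 - 1))
/-- `Q2`: auxiliary def of the lens-6 g8e development GoldenPair10 (census pair #10; instances of 28994/4280) — see the module docstring; verbatim from the lens file. -/
def Q2 (c : ℚ) : MvPolynomial (Fin 2) ℚ := (1 + X 0) * (1 + X 0 + C c * X 0 * (X 1 - 1))
/-- `QG`: auxiliary def of the lens-6 g8e development GoldenPair10 (census pair #10; instances of 28994/4280) — see the module docstring; verbatim from the lens file. -/
def QG (c : ℚ) : MvPolynomial (Fin 2) ℚ := (1 + X 0) ^ 2 + C c * X 0 * X 1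
/-- `QP`: auxiliary def of the lens-6 g8e development GoldenPair10 (census pair #10; instances of 28994/4280) — see the module docstring; verbatim from the lens file. -/
def QP (c : ℚ) : MvPolynomial (Fin 2) ℚ := (1 + X 0) * ((1 + X 0) ^ 2 + C c * X 0 * X 1)

/-- `PΔ_ge`: auxiliary theorem of the lens-6 g8e development GoldenPair10 (census pair #10; instances of 28994/4280) — see the module docstring; verbatim from the lens file. -/
theorem PΔ_ge {c : ℚ} (hc : -1 ≤ c ∧ c ≤ 1) {z : Fin 2 → ℝ} (hz : z ∈ sbDom zeroE omE) :
    (3 / 4 : ℝ) ≤ aeval z (PΔ c) := by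
  obtain ⟨⟨h0, h0'⟩, h1, h2⟩ := mem_sbDom.1 hz
  simp only [zeroE_f, omE_f] at h1 h2
  simp only [PΔ, map_add, map_mul, map_one, aeval_C, aeval_X, eq_ratCast]
  have hp : 0 ≤ z 0 * z 1 := mul_nonneg h0 h1
  have hq1 : z 0 * z 1 ≤ z 0 * (1 - z 0) := mul_le_mul_of_nonneg_left h2 h0
  have hq : z 0 * z 1 ≤ 1 / 4 := by nlinarith [sq_nonneg (z 0 - 1 / 2)]
  have := cmul_ge_neg hc hp
  nlinarith

/-- `PΔs_ge`: auxiliary theorem of the lens-6 g8e development GoldenPair10 (census pair #10; instances of 28994/4280) — see the module docstring; verbatim from the lens file. -/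
theorem PΔs_ge {c : ℚ} (hc : -1 ≤ c ∧ c ≤ 1) {z : Fin 2 → ℝ} (hz : z ∈ sbDom oneE omE.onePlus) :
    (3 / 4 : ℝ) ≤ aeval z (PΔs c) := by
  obtain ⟨⟨h0, h0'⟩, h1, h2⟩ := mem_sbDom.1 hz
  simp only [oneE_f, Edge.onePlus_f, omE_f] at h1 h2
  simp only [PΔs, map_add, map_mul, map_sub, map_one, aeval_C, aeval_X, eq_ratCast]
  have hp : 0 ≤ z 0 * (z 1 - 1) := mul_nonneg h0 (by linarith)
  have hq1 : z 0 * (z 1 - 1) ≤ z 0 * (1 - z 0) := mul_le_mul_of_nonneg_left (by linarith) h0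
  have hq : z 0 * (z 1 - 1) ≤ 1 / 4 := by nlinarith [sq_nonneg (z 0 - 1 / 2)]
  have := cmul_ge_neg hc hp
  nlinarith

/-- `Q1_ge`: auxiliary theorem of the lens-6 g8e development GoldenPair10 (census pair #10; instances of 28994/4280) — see the module docstring; verbatim from the lens file. -/
theorem Q1_ge {c : ℚ} (hc : -1 ≤ c ∧ c ≤ 1) {z : Fin 2 → ℝ} (hz : z ∈ sbDom oneE tqE.onePlus) :
    (1 : ℝ) ≤ aeval z (Q1 c) := by
  obtain ⟨⟨h0, h0'⟩, h1, h2⟩ := mem_sbDom.1 hz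
  simp only [oneE_f, Edge.onePlus_f, tqE_f] at h1 h2
  simp only [Q1, map_add, map_mul, map_sub, map_one, aeval_C, aeval_X, eq_ratCast]
  have hm : 0 ≤ z 1 - 1 := by linarith
  have hm' : z 1 - 1 ≤ z 0 := by
    have h3 : z 0 / (1 + z 0) ≤ z 0 := div_le_self h0 (by linarith)
    linarith
  have := cmul_ge_neg hc hm
  nlinarith

/-- `Q2_ge`: auxiliary theorem of the lens-6 g8e development GoldenPair10 (census pair #10; instances of 28994/4280) — see the module docstring; verbatim from the lens file. -/
theorem Q2_ge {c : ℚ} (hc : -1 ≤ c ∧ c ≤ 1) {z : Fin 2 → ℝ} (hz : z ∈ sbDom oneE rE.onePlus) :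
    (1 : ℝ) ≤ aeval z (Q2 c) := by
  obtain ⟨⟨h0, h0'⟩, h1, h2⟩ := mem_sbDom.1 hz
  simp only [oneE_f, Edge.onePlus_f, rE_f] at h1 h2
  simp only [Q2, map_add, map_mul, map_sub, map_one, aeval_C, aeval_X, eq_ratCast]
  have hm : 0 ≤ z 0 * (z 1 - 1) := mul_nonneg h0 (by linarith)
  have hm' : z 0 * (z 1 - 1) ≤ z 0 := by
    have h3 : z 1 - 1 ≤ 1 := by
      have : 1 / (1 + z 0) ≤ 1 := by rw [div_le_one (by linarith)]; linarith
      linarith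
    nlinarith
  have := cmul_ge_neg hc hm
  nlinarith

/-- `QG_pos`: auxiliary theorem of the lens-6 g8e development GoldenPair10 (census pair #10; instances of 28994/4280) — see the module docstring; verbatim from the lens file. -/
private theorem QG_pos {c : ℚ} (hc : -1 ≤ c ∧ c ≤ 1) {x : Fin 2 → ℝ} (hx : x ∈ cube 2) : 0 < aeval x (QG c) := by
  have h0 := (hx 0).1; have h1 := (hx 1).1; have h1' := (hx 1).2
  simp only [QG, map_add, map_mul, map_pow, map_one, aeval_C, aeval_X, eq_ratCast]
  have hm : 0 ≤ x 0 * x 1 := mul_nonneg h0 h1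
  have := cmul_ge_neg hc hm
  nlinarith

/-- `QP_pos`: auxiliary theorem of the lens-6 g8e development GoldenPair10 (census pair #10; instances of 28994/4280) — see the module docstring; verbatim from the lens file. -/
private theorem QP_pos {c : ℚ} (hc : -1 ≤ c ∧ c ≤ 1) {x : Fin 2 → ℝ} (hx : x ∈ cube 2) : 0 < aeval x (QP c) := by
  have h := QG_pos hc hx
  have h0 := (hx 0).1
  simp only [QG, map_add, map_mul, map_pow, map_one, aeval_C, aeval_X, eq_ratCast] at h
  simp only [QP, map_add, map_mul, map_pow, map_one, aeval_C, aeval_X, eq_ratCast]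
  positivity

/-- `abs_aeval_one_le`: auxiliary theorem of the lens-6 g8e development GoldenPair10 (census pair #10; instances of 28994/4280) — see the module docstring; verbatim from the lens file. -/
theorem abs_aeval_one_le (z : Fin 2 → ℝ) : |aeval z (1 : MvPolynomial (Fin 2) ℚ)| ≤ 1 := by simp
/-- `abs_aeval_X0_le`: auxiliary theorem of the lens-6 g8e development GoldenPair10 (census pair #10; instances of 28994/4280) — see the module docstring; verbatim from the lens file. -/
private theorem abs_aeval_X0_le {L U : Edge} {z : Fin 2 → ℝ} (hz : z ∈ sbDom L U) :
    |aeval z (X 0 : MvPolynomial (Fin 2) ℚ)| ≤ 1 := by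
  obtain ⟨⟨h0, h0'⟩, -, -⟩ := mem_sbDom.1 hz
  rw [aeval_X, abs_of_nonneg h0]; exact h0'

/-- `TΔ(c) = [Δ, 1/(1 + c w v)]`, its fibre translate, and the two charted halves. -/
def TΔ (c : ℚ) (hc : -1 ≤ c ∧ c ≤ 1) : KZ.IntegralRep 2 :=
  BRq zeroE omE 1 (PΔ c) (3 / 4) 1 (by norm_num) (fun _ hz => PΔ_ge hc hz) fun z _ => abs_aeval_one_le z
/-- `TΔs`: auxiliary def of the lens-6 g8e development GoldenPair10 (census pair #10; instances of 28994/4280) — see the module docstring; verbatim from the lens file. -/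
def TΔs (c : ℚ) (hc : -1 ≤ c ∧ c ≤ 1) : KZ.IntegralRep 2 :=
  BRq oneE omE.onePlus 1 (PΔs c) (3 / 4) 1 (by norm_num) (fun _ hz => PΔs_ge hc hz)
    fun z _ => abs_aeval_one_le z
/-- `R1`: auxiliary def of the lens-6 g8e development GoldenPair10 (census pair #10; instances of 28994/4280) — see the module docstring; verbatim from the lens file. -/
def R1 (c : ℚ) (hc : -1 ≤ c ∧ c ≤ 1) : KZ.IntegralRep 2 :=
  BRq oneE tqE.onePlus 1 (Q1 c) 1 1 one_pos (fun _ hz => Q1_ge hc hz) fun z _ => abs_aeval_one_le z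
/-- `R2`: auxiliary def of the lens-6 g8e development GoldenPair10 (census pair #10; instances of 28994/4280) — see the module docstring; verbatim from the lens file. -/
def R2 (c : ℚ) (hc : -1 ≤ c ∧ c ≤ 1) : KZ.IntegralRep 2 :=
  BRq oneE rE.onePlus 1 (Q2 c) 1 1 one_pos (fun _ hz => Q2_ge hc hz) fun z _ => abs_aeval_one_le z
/-- The box forms `Pa(c) = [□², 1/((1+u)Q_G)]`, `Pb(c) = [□², u/((1+u)Q_G)]`, `G(c) = [□², 1/Q_G]`,
`Q_G = (1+u)² + c u σ`. -/
def Pa (c : ℚ) (hc : -1 ≤ c ∧ c ≤ 1) : RFun 2 := ⟨1, QP c, fun _ hx => (QP_pos hc hx).ne'⟩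
/-- `Pb`: auxiliary def of the lens-6 g8e development GoldenPair10 (census pair #10; instances of 28994/4280) — see the module docstring; verbatim from the lens file. -/
def Pb (c : ℚ) (hc : -1 ≤ c ∧ c ≤ 1) : RFun 2 := ⟨X 0, QP c, fun _ hx => (QP_pos hc hx).ne'⟩
/-- `Gc`: auxiliary def of the lens-6 g8e development GoldenPair10 (census pair #10; instances of 28994/4280) — see the module docstring; verbatim from the lens file. -/
def Gc (c : ℚ) (hc : -1 ≤ c ∧ c ≤ 1) : RFun 2 := ⟨1, QG c, fun _ hx => (QG_pos hc hx).ne'⟩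

/-- (m1) fibre translation `TΔ ≡ TΔs`. -/
private theorem m1 (c : ℚ) (hc : -1 ≤ c ∧ c ≤ 1) : KZ.of (TΔ c hc) - KZ.of (TΔs c hc) ∈ KZ.relations := by
  refine rel_shift omE (TΔ c hc) (TΔs c hc) rfl rfl fun z _ => ?_
  simp only [TΔ, TΔs, BRq_integrand, PΔ, PΔs, map_add, map_mul, map_sub, map_one, aeval_C, aeval_X,
    eq_ratCast, snoc2_zero, snoc2_one, init2_zero, add_sub_cancel_left]

/-- (m2) base cut at `w = ½`. -/
private theorem m2 (c : ℚ) (hc : -1 ≤ c ∧ c ≤ 1) :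
    KZ.of (TΔs c hc) - KZ.of (VB (TΔs c hc) omE rfl 0 (1 / 2) le_rfl (by norm_num)) -
      KZ.of (VB (TΔs c hc) omE rfl (1 / 2) 1 (by norm_num) le_rfl) ∈ KZ.relations :=
  vcut (TΔs c hc) omE rfl (1 / 2) (by norm_num) (by norm_num)

/-- (m3) base chart `w = 1/(1+u)` (reflection ∘ Möbius): `R1 ≡` the right half. -/
theorem m3 (c : ℚ) (hc : -1 ≤ c ∧ c ≤ 1) :
    KZ.of (R1 c hc) - KZ.of (VB (TΔs c hc) omE rfl (1 / 2) 1 (by norm_num) le_rfl) ∈ KZ.relations := by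
  obtain ⟨κ, hκ⟩ : ∃ κ : ℝ → ℝ, κ = fun t => 1 / (1 + t) := ⟨_, rfl⟩
  obtain ⟨κd, hκd⟩ : ∃ κd : ℝ → ℝ, κd = fun t => -1 / ((1 + t) * (1 + t)) := ⟨_, rfl⟩
  have hder : ∀ t ∈ Icc (0 : ℝ) 1, HasDerivAt κ (κd t) t := by
    intro t ht
    simp only [hκ, hκd]
    have h1 : (1 + t) ≠ 0 := by linarith [ht.1]
    have h : HasDerivAt (fun x : ℝ => 1 / (1 + x)) ((0 * (1 + t) - 1 * 1) / (1 + t) ^ 2) t :=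
      (hasDerivAt_const t 1).div ((hasDerivAt_id' t).const_add 1) h1
    exact h.congr_deriv (by field_simp; try ring)
  obtain ⟨hinj, himg⟩ := injOn_image_of_deriv_neg' zero_le_one hder fun t ht => by
    rw [hκd]; have := ht.1; exact div_neg_of_neg_of_pos (by norm_num) (by positivity)
  have hκ0 : κ 0 = 1 := by rw [hκ]; norm_num
  have hκ1 : κ 1 = 1 / 2 := by rw [hκ]; norm_num
  rw [hκ0, hκ1] at himg
  refine rel_base κ κd 1 (1 + X 0) (fun y hy => ?_) (fun y hy => ?_) hder hinj (1 / 2) 1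
    (by rw [himg]; norm_num) (fun y => tqE.onePlus.f (y 0)) (fun y => omE.onePlus.f (y 0))
    (fun y hy => ?_) _ _ rfl rfl fun z hz => ?_
  · have := (I01 hy).1; simp only [map_add, map_one, aeval_X]; positivity
  · simp [hκ]
  · have h0 := (I01 hy).1
    simp only [Edge.onePlus_f, tqE_f, omE_f, hκ]
    have h1 : (1 + y 0) ≠ 0 := by linarith
    field_simp
    try ring
  · have hz' : z ∈ sbDom oneE tqE.onePlus := hz
    have hQ := Q1_ge hc hz'
    obtain ⟨⟨h0, h0'⟩, h1, h2⟩ := mem_sbDom.1 hz'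
    simp only [Q1, map_add, map_mul, map_sub, map_one, aeval_C, aeval_X, eq_ratCast] at hQ
    simp only [R1, TΔs, BRq_integrand, VB_integrand, Q1, PΔs, map_add, map_mul, map_sub, map_one,
      aeval_C, aeval_X, eq_ratCast, snoc2_zero, snoc2_one, hκ, hκd]
    rw [show |(-1 : ℝ) / ((1 + z 0) * (1 + z 0))| = 1 / ((1 + z 0) * (1 + z 0)) by
      rw [abs_div, abs_neg, abs_one, abs_of_pos (by positivity)]]
    have hu : (1 : ℝ) + z 0 ≠ 0 := by linarith
    have hD : (1 : ℝ) + z 0 + (c : ℝ) * (z 1 - 1) ≠ 0 := by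
      intro h; rw [h, mul_zero] at hQ; linarith
    have hD' : (1 : ℝ) + (c : ℝ) * (1 / (1 + z 0)) * (z 1 - 1) ≠ 0 := by
      rw [show (1 : ℝ) + (c : ℝ) * (1 / (1 + z 0)) * (z 1 - 1) = (1 + z 0 + (c : ℝ) * (z 1 - 1)) / (1 + z 0)
        by field_simp; try ring]
      exact div_ne_zero hD hu
    field_simp
    try ring

/-- (m4) base chart `w = u/(1+u)`: `R2 ≡` the left half. -/
theorem m4 (c : ℚ) (hc : -1 ≤ c ∧ c ≤ 1) :
    KZ.of (R2 c hc) - KZ.of (VB (TΔs c hc) omE rfl 0 (1 / 2) le_rfl (by norm_num)) ∈ KZ.relations := by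
  obtain ⟨κ, hκ⟩ : ∃ κ : ℝ → ℝ, κ = fun t => t / (1 + t) := ⟨_, rfl⟩
  obtain ⟨κd, hκd⟩ : ∃ κd : ℝ → ℝ, κd = fun t => 1 / ((1 + t) * (1 + t)) := ⟨_, rfl⟩
  have hder : ∀ t ∈ Icc (0 : ℝ) 1, HasDerivAt κ (κd t) t := by
    intro t ht
    simp only [hκ, hκd]
    have h1 : (1 + t) ≠ 0 := by linarith [ht.1]
    have h : HasDerivAt (fun x : ℝ => x / (1 + x)) ((1 * (1 + t) - t * 1) / (1 + t) ^ 2) t :=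
      (hasDerivAt_id' t).div ((hasDerivAt_id' t).const_add 1) h1
    exact h.congr_deriv (by field_simp; try ring)
  obtain ⟨hinj, himg⟩ := injOn_image_of_deriv_pos' zero_le_one hder fun t ht => by
    rw [hκd]; have := ht.1; positivity
  have hκ0 : κ 0 = 0 := by rw [hκ]; norm_num
  have hκ1 : κ 1 = 1 / 2 := by rw [hκ]; norm_num
  rw [hκ0, hκ1] at himg
  refine rel_base κ κd (X 0) (1 + X 0) (fun y hy => ?_) (fun y hy => ?_) hder hinj 0 (1 / 2)
    (by rw [himg]; norm_num) (fun y => rE.onePlus.f (y 0)) (fun y => omE.onePlus.f (y 0))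
    (fun y hy => ?_) _ _ rfl rfl fun z hz => ?_
  · have := (I01 hy).1; simp only [map_add, map_one, aeval_X]; positivity
  · simp [hκ]
  · have h0 := (I01 hy).1
    simp only [Edge.onePlus_f, rE_f, omE_f, hκ]
    have h1 : (1 + y 0) ≠ 0 := by linarith
    field_simp
    try ring
  · have hz' : z ∈ sbDom oneE rE.onePlus := hz
    have hQ := Q2_ge hc hz'
    obtain ⟨⟨h0, h0'⟩, h1, h2⟩ := mem_sbDom.1 hz'
    simp only [Q2, map_add, map_mul, map_sub, map_one, aeval_C, aeval_X, eq_ratCast] at hQ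
    simp only [R2, TΔs, BRq_integrand, VB_integrand, Q2, PΔs, map_add, map_mul, map_sub, map_one,
      aeval_C, aeval_X, eq_ratCast, snoc2_zero, snoc2_one, hκ, hκd]
    rw [show |(1 : ℝ) / ((1 + z 0) * (1 + z 0))| = 1 / ((1 + z 0) * (1 + z 0)) by
      rw [abs_of_pos (by positivity)]]
    have hu : (1 : ℝ) + z 0 ≠ 0 := by linarith
    have hD : (1 : ℝ) + z 0 + (c : ℝ) * z 0 * (z 1 - 1) ≠ 0 := by
      intro h; rw [h, mul_zero] at hQ; linarith
    have hD' : (1 : ℝ) + (c : ℝ) * (z 0 / (1 + z 0)) * (z 1 - 1) ≠ 0 := by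
      rw [show (1 : ℝ) + (c : ℝ) * (z 0 / (1 + z 0)) * (z 1 - 1) =
        (1 + z 0 + (c : ℝ) * z 0 * (z 1 - 1)) / (1 + z 0) by field_simp; try ring]
      exact div_ne_zero hD hu
    field_simp
    try ring

/-- (m5) affine fibre map `s = 1 + uσ/(1+u)`: `Pb ≡ R1`. -/
theorem m5 (c : ℚ) (hc : -1 ≤ c ∧ c ≤ 1) : KZ.of (Pb c hc).rep - KZ.of (R1 c hc) ∈ KZ.relations := by
  refine box_to_band tqE (fun t ht => by have := ht.1; simp only [tqE_f]; positivity)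
    (fun t ht => ?_) (Pb c hc) (R1 c hc) rfl fun z hz h0 h0' => ?_
  · have h1 : (1 : ℝ) + t ≠ 0 := by linarith [ht.1]
    apply DifferentiableAt.differentiableWithinAt
    show DifferentiableAt ℝ (fun t : ℝ => t / (1 + t)) t
    fun_prop (disch := assumption)
  · have hG := QG_pos hc hz
    have h1u := (hz 1).2
    simp only [QG, map_add, map_mul, map_pow, map_one, aeval_C, aeval_X, eq_ratCast] at hG
    simp only [RFun.fn, Pb, R1, QP, Q1, BRq_integrand, map_add, map_mul, map_sub, map_pow, map_one,
      aeval_C, aeval_X, eq_ratCast, snoc2_zero, snoc2_one, init2_zero, tqE_f, add_sub_cancel_left]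
    have hu : (1 : ℝ) + z 0 ≠ 0 := by linarith
    have hD : ((1 : ℝ) + z 0) ^ 2 + (c : ℝ) * z 0 * z 1 ≠ 0 := hG.ne'
    have hD' : (1 : ℝ) + z 0 + (c : ℝ) * (z 0 / (1 + z 0) * z 1) ≠ 0 := by
      rw [show (1 : ℝ) + z 0 + (c : ℝ) * (z 0 / (1 + z 0) * z 1) =
        ((1 + z 0) ^ 2 + (c : ℝ) * z 0 * z 1) / (1 + z 0) by field_simp; try ring]
      exact div_ne_zero hD hu
    field_simp
    try ring

/-- (m6) affine fibre map `s = 1 + σ/(1+u)`: `Pa ≡ R2`. -/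
theorem m6 (c : ℚ) (hc : -1 ≤ c ∧ c ≤ 1) : KZ.of (Pa c hc).rep - KZ.of (R2 c hc) ∈ KZ.relations := by
  refine box_to_band rE (fun t ht => by have := ht.1; simp only [rE_f]; positivity)
    (fun t ht => ?_) (Pa c hc) (R2 c hc) rfl fun z hz h0 h0' => ?_
  · have h1 : (1 : ℝ) + t ≠ 0 := by linarith [ht.1]
    apply DifferentiableAt.differentiableWithinAt
    show DifferentiableAt ℝ (fun t : ℝ => 1 / (1 + t)) t
    fun_prop (disch := assumption)
  · have hG := QG_pos hc hz
    have h1u := (hz 1).2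
    simp only [QG, map_add, map_mul, map_pow, map_one, aeval_C, aeval_X, eq_ratCast] at hG
    simp only [RFun.fn, Pa, R2, QP, Q2, BRq_integrand, map_add, map_mul, map_sub, map_pow, map_one,
      aeval_C, aeval_X, eq_ratCast, snoc2_zero, snoc2_one, init2_zero, rE_f, add_sub_cancel_left]
    have hu : (1 : ℝ) + z 0 ≠ 0 := by linarith
    have hD : ((1 : ℝ) + z 0) ^ 2 + (c : ℝ) * z 0 * z 1 ≠ 0 := hG.ne'
    have hD' : (1 : ℝ) + z 0 + (c : ℝ) * z 0 * (1 / (1 + z 0) * z 1) ≠ 0 := by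
      rw [show (1 : ℝ) + z 0 + (c : ℝ) * z 0 * (1 / (1 + z 0) * z 1) =
        ((1 + z 0) ^ 2 + (c : ℝ) * z 0 * z 1) / (1 + z 0) by field_simp; try ring]
      exact div_ne_zero hD hu
    field_simp
    try ring

/-- (m7) merge: `G(c) ≡ Pa(c) + Pb(c)` (rule 1b). -/
theorem m7 (c : ℚ) (hc : -1 ≤ c ∧ c ≤ 1) :
    KZ.of (Gc c hc).rep - KZ.of (Pa c hc).rep - KZ.of (Pb c hc).rep ∈ KZ.relations := by
  refine rel_lin (Gc c hc) (Pa c hc) (Pb c hc) fun x hx => ?_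
  have hG := (QG_pos hc hx).ne'
  have h0 := (hx 0).1
  simp only [QG, map_add, map_mul, map_pow, map_one, aeval_C, aeval_X, eq_ratCast] at hG
  simp only [RFun.fn, Gc, Pa, Pb, QG, QP, map_add, map_mul, map_pow, map_one, aeval_C, aeval_X,
    eq_ratCast]
  have hu : (1 : ℝ) + x 0 ≠ 0 := by linarith
  field_simp
  try ring

/-- **The c-trick**: `TΔ(c) ≡ G(c)` in `KZ.relations`. -/
theorem tΔ_G (c : ℚ) (hc : -1 ≤ c ∧ c ≤ 1) : KZ.of (TΔ c hc) - KZ.of (Gc c hc).rep ∈ KZ.relations := by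
  have h := sub_mem (sub_mem (sub_mem (sub_mem (sub_mem (add_mem (m1 c hc) (m2 c hc)) (m4 c hc))
    (m3 c hc)) (m6 c hc)) (m5 c hc)) (m7 c hc)
  convert h using 1
  abel

/-! ## §6 The B-side: `2·B10 ≡ G(1) + G(−1)` -/

/-- Census row #10, B-side: `B10 = [□², dx dy/(1 + y + 2xy + y²)]` (census orientation), its swap
`B10s = [□², du dσ/(1 + u + u² + 2uσ)]`, the doubled integrand, and `Gmr = [□², 1/(1 + u + u² + uσ)]`. -/
def QB10 : MvPolynomial (Fin 2) ℚ := 1 + X 1 + 2 * X 0 * X 1 + X 1 ^ 2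
/-- `QB10s`: auxiliary def of the lens-6 g8e development GoldenPair10 (census pair #10; instances of 28994/4280) — see the module docstring; verbatim from the lens file. -/
def QB10s : MvPolynomial (Fin 2) ℚ := 1 + X 0 + 2 * X 0 * X 1 + X 0 ^ 2
/-- `QW`: auxiliary def of the lens-6 g8e development GoldenPair10 (census pair #10; instances of 28994/4280) — see the module docstring; verbatim from the lens file. -/
def QW : MvPolynomial (Fin 2) ℚ := 1 + X 0 + X 0 ^ 2 + X 0 * X 1

end Summit.KontsevichZagierPeriods.RootDecompQuadraticDescent.GoldenPair

end
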